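import Summits.Ventures.LatticeQCDFlow.Scaling.StarAdditiveCertificateList
import Summits.Ventures.LatticeQCDFlow.Scaling.StarSlowSwapLaw

/-!
HONEST FRAMING: exact (Metropolis-corrected) sampling algorithms for lattice gauge theory; figures
of merit are autocorrelation/cost numbers at stated couplings and volumes; no continuum-physics
claim.

# StarSlowSwapLawList — THE SLOW-SWAP LAW OF CHAPTER U FOR ANY HUB LIST: `t_mix(ε) ≤ ⌈(12m(t+h)/(p·h·t·c))·log((eK/(p·W_lo)+1)/ε)⌉₊` WHEN EVERY COLD LEVEL IS LISTED `≥ c` TIMES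
# (lean-2 GEN-34, ours)

Venture-side (OURS).  Cell `lqcd-flow` (pub-lqcd), unit `pub-lqcd-lean-2-g34`, 2026-08-29.  Chapter U, file 10 = file 9 (`StarAdditiveCertificateList`, any hub list) on file 3's certificate
data (`slowSwap_certificate`): the homogeneous `q`-content star with hub list `(0, κ_r+1)` of length `m` listing every cold level at least `c ≥ 1` times (no uniformity), identity maps,
exact hot redraws (`w_0 > 0`), idle cold levels, `0 < t < 1`, hub domination `p·μ_1 ≤ μ_0`, `W_lo ≤ max{W(u),W(v)}` off the diagonal, SLOW SWAPS `4t ≤ h`.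

* **`homStar_mixingTime_le_slowSwap_list`** — `t_mix(ε) ≤ ⌈(4/((1−t)w_0·ρ))·log((e·(K·(1/(p·W_lo)))+1)/ε)⌉₊`, `ρ = (t/(t+(1−t)w_0))·(p/3)·c/m`;
* **`homStar_mixingTime_le_slowSwap_list'`** — the closed form `⌈(12m(t+h)/(p·h·t·c))·log((eK/(p·W_lo)+1)/ε)⌉₊` — the `m/c` of chapter M in place of U3's `K`.

NOT CLAIMED: anything measured.  Literature grade (cell rule): OWN; nothing cited as a fact; no new bib keys.
-/

noncomputable section
open Finset Function
open Literature.Probability.MarkovChains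

namespace Summit.Ventures.LatticeQCDFlow.Scaling

section Law
variable {K m : ℕ} {S : Type*} [Fintype S] [DecidableEq S] {μ : Fin (K + 1) → S → ℝ}
variable (κ : Fin m → Fin K)
variable {M : Fin (K + 1) → S → S → ℝ} {w : Fin (K + 1) → ℝ} {t : ℝ}

/-- **ITEM 1 (i) AT SLOW SWAPS, ANY HUB LIST:** every cold level listed `≥ c ≥ 1` times, `4t ≤ (1−t)w_0` ⇒
**`t_mix(ε) ≤ ⌈(4/((1−t)w_0·ρ))·log((e·(K·(1/(p·W_lo))) + 1)/ε)⌉₊`, `ρ = (t/(t + (1−t)w_0))·(p/3)·c/m`**. [ours] -/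
theorem homStar_mixingTime_le_slowSwap_list [Nonempty S] (hm : 1 ≤ m) (ht0 : 0 < t) (ht1 : t < 1) (hw0 : ∀ k, 0 ≤ w k) (hw00 : 0 < w 0)
    (hw1 : ∑ k, w k = 1) (hμ : ∀ k x, 0 < μ k x) (hμ1 : ∀ k, ∑ u, μ k u = 1) (hM0 : ∀ u v, M 0 u v = μ 0 v)
    (hidle : ∀ i : Fin K, ∀ u v, M i.succ u v = if v = u then 1 else 0) (hhom : ∀ i : Fin K, μ i.succ = μ 1)
    {c : ℕ} (hc1 : 1 ≤ c) (hc : ∀ i : Fin K, c ≤ (univ.filter fun r : Fin m => κ r = i).card)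
    {p : ℝ} (hp0 : 0 < p) (hp : ∀ u, p * μ 1 u ≤ μ 0 u)
    {Wlo : ℝ} (hWlo0 : 0 < Wlo) (hWlo : ∀ u v, u ≠ v → Wlo ≤ max (μ 1 u / μ 0 u) (μ 1 v / μ 0 v))
    (hslow : 4 * t ≤ (1 - t) * w 0) {ε : ℝ} (hε : 0 < ε) :
    mixingTime (fun y z : Fin (K + 1) → S =>
        t * ptGraphSwap μ (fun r : Fin m => (((0 : Fin (K + 1)), (κ r).succ) : Fin (K + 1) × Fin (K + 1))) (fun _ : Fin m => Equiv.refl S) y z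
          + (1 - t) * prodKernel w M y z) (tensorFun μ) ε
      ≤ ⌈1 / ((1 - t) * w 0 * (t / (t + (1 - t) * w 0) * (p / 3) * c / m) / 4) * Real.log ((Real.exp 1 * (K * (1 / (p * Wlo))) + 1) / ε)⌉₊ := by
  classical
  have hh0 : 0 < (1 - t) * w 0 := mul_pos (by linarith) hw00
  have hσ0 : 0 < t / (t + (1 - t) * w 0) := div_pos ht0 (by linarith)
  have hσ5 : t / (t + (1 - t) * w 0) ≤ 1 / 5 := by rw [div_le_iff₀ (by linarith)]; linarith
  let acc : S → S → ℝ := fun u v => min 1 (μ 0 v * μ 1 u / (μ 0 u * μ 1 v))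
  let G : S → S → ℝ := fun u v => if u = v then 0 else 1 / Wlo * max (μ 1 u / μ 0 u) (μ 1 v / μ 0 v)
  let E : S → S → ℝ := fun u v => 1 / (1 - 2 * (t / (t + (1 - t) * w 0))) * G u v
  let net : S → S → S → ℝ := fun z u v => min (acc z u) (acc z v) * (G u v - t / (t + (1 - t) * w 0) * E u v)
      - (acc z u - min (acc z u) (acc z v)) * (G z v - G u v + t / (t + (1 - t) * w 0) * E u z)
      - (acc z v - min (acc z u) (acc z v)) * (G u z - G u v + t / (t + (1 - t) * w 0) * E z v)
  obtain ⟨hGd, hG1, hG0, hGmax, hE0, hN, hD, hR⟩ := slowSwap_certificate (fun u => hμ 0 u) (fun u => hμ 1 u) (hμ1 1) hp0 hp hWlo0 hWlo hσ0 hσ5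
    (acc := acc) (G := G) (E := E) (fun u v => rfl) (fun u v => rfl) (fun u v => rfl) (net := net) (fun z u v => rfl)
  have hp1 : p ≤ 1 := by
    have h := Finset.sum_le_sum fun u (_ : u ∈ (univ : Finset S)) => hp u
    rw [← Finset.mul_sum, hμ1 1, hμ1 0, mul_one] at h; exact h
  exact homStar_mixingTime_le_of_additiveCertificate_list κ hm ht0 ht1 hw0 hw00 hw1 hμ hμ1 hM0 hidle hhom hc1 hc (acc := acc) (fun u v => rfl)
    hGd hG1 hG0 hGmax hE0 rfl (net := net) (fun z u v => rfl) hN hD hR (by positivity) (by linarith) hε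

/-- **THE CLOSED FORM: `t_mix(ε) ≤ ⌈(12m(t+h)/(p·h·t·c))·log((eK/(p·W_lo) + 1)/ε)⌉₊`**, `h = (1−t)w_0`, under `4t ≤ h`, for any hub list with multiplicities `≥ c`. [ours] -/
theorem homStar_mixingTime_le_slowSwap_list' [Nonempty S] (hm : 1 ≤ m) (ht0 : 0 < t) (ht1 : t < 1) (hw0 : ∀ k, 0 ≤ w k) (hw00 : 0 < w 0)
    (hw1 : ∑ k, w k = 1) (hμ : ∀ k x, 0 < μ k x) (hμ1 : ∀ k, ∑ u, μ k u = 1) (hM0 : ∀ u v, M 0 u v = μ 0 v)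
    (hidle : ∀ i : Fin K, ∀ u v, M i.succ u v = if v = u then 1 else 0) (hhom : ∀ i : Fin K, μ i.succ = μ 1)
    {c : ℕ} (hc1 : 1 ≤ c) (hc : ∀ i : Fin K, c ≤ (univ.filter fun r : Fin m => κ r = i).card)
    {p : ℝ} (hp0 : 0 < p) (hp : ∀ u, p * μ 1 u ≤ μ 0 u)
    {Wlo : ℝ} (hWlo0 : 0 < Wlo) (hWlo : ∀ u v, u ≠ v → Wlo ≤ max (μ 1 u / μ 0 u) (μ 1 v / μ 0 v))
    (hslow : 4 * t ≤ (1 - t) * w 0) {ε : ℝ} (hε : 0 < ε) :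
    mixingTime (fun y z : Fin (K + 1) → S =>
        t * ptGraphSwap μ (fun r : Fin m => (((0 : Fin (K + 1)), (κ r).succ) : Fin (K + 1) × Fin (K + 1))) (fun _ : Fin m => Equiv.refl S) y z
          + (1 - t) * prodKernel w M y z) (tensorFun μ) ε
      ≤ ⌈12 * m * (t + (1 - t) * w 0) / (p * ((1 - t) * w 0) * t * c) * Real.log ((Real.exp 1 * K / (p * Wlo) + 1) / ε)⌉₊ := by
  have main := homStar_mixingTime_le_slowSwap_list κ hm ht0 ht1 hw0 hw00 hw1 hμ hμ1 hM0 hidle hhom hc1 hc hp0 hp hWlo0 hWlo hslow hε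
  have hmpos : (0 : ℝ) < m := Nat.cast_pos.mpr (by omega)
  have hcpos : (0 : ℝ) < c := Nat.cast_pos.mpr (by omega)
  have hh0 : (1 - t) * w 0 ≠ 0 := (mul_pos (by linarith) hw00).ne'
  have hth : t + (1 - t) * w 0 ≠ 0 := by have := mul_pos (show (0:ℝ) < 1 - t by linarith) hw00; linarith
  have e : 1 / ((1 - t) * w 0 * (t / (t + (1 - t) * w 0) * (p / 3) * c / m) / 4) = 12 * m * (t + (1 - t) * w 0) / (p * ((1 - t) * w 0) * t * c) := by
    field_simp
    ring
  have e2 : Real.exp 1 * (K * (1 / (p * Wlo))) = Real.exp 1 * K / (p * Wlo) := by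
    field_simp
  rw [e, e2] at main
  exact main

end Law

end Summit.Ventures.LatticeQCDFlow.Scaling

end
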